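import Mathlib
import Literature.Computability.AlgebraicComplexity.GrenetEquivariant
import Literature.Computability.AlgebraicComplexity.LRPencilOfMatrix
import HarnessLib

/-!
# Crux `FreeSubtorus.OrbitDimensionBound` (stmt-ValiantsHypothesis-16133), registered line
`Cruxes/OrbitDimensionBound/Lines/affine_multiple.lean`, stub 2 `stub_absorbingSacrifice` —
branch (β): LIFTS THROUGH A SUBSTITUTION WITH CONSTANTS (helper; the stub stays OPEN)

The floor's `FreeSubtorusSubtorusCovering.stub_substLifts` (crux 16134, line pair-sacrifice) transports
the exact `GL_m × GL_m` lifts of a `T_Λ`-equivariant affine determinantal representation `B` through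
the PAIR-SACRIFICE substitution (free block kept, `1` on the sacrificed diagonal, `0` elsewhere):
every free-torus generator `diag(d'_k e'_l)` that EXTENDS to a torus element `(d, e)` of `T_Λ`
with `d_j e_j = 1` on the sacrificed diagonal lifts for `B.map (aeval g)`.  Stub 2 of line
`affine_multiple` (the ABSORBING sacrifice, card cases (a)–(c); branch (β) "always pin" of
`HOME/lmr/NOTE-p8g8-AffineMultiple-stubs.md`) needs the same transport for a substitution that
puts ARBITRARY CONSTANTS on the three non-free blocks — non-zero `t_j` on the sacrificed diagonal,
a pinned `u₀` at one off-free position, `0` elsewhere.  This file proves that generalisation once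
and for all, for any represented polynomial `f` and any constants:

* `substLifts_const` — if `g` keeps the free block and sends every other variable `x_p` to a
  constant `C (c p)`, and the free generator `diag(d'_k e'_l)` extends to `(d, e) ∈ (ℂˣ)^{n'+s} ×
  (ℂˣ)^{n'+s}` satisfying the `Λ`-relations, agreeing with `(d', e')` on the free block, and FIXING
  EVERY NON-ZERO CONSTANT (`d_{p.1} e_{p.2} = 1` whenever `c p ≠ 0` — the sacrificed diagonal and
  the pin; killed positions impose nothing), then `diag(d'_k e'_l)` lifts exactly for
  `B.map (aeval g)`, with the SAME lift `(g₁, h₁)` as `diag(d_k e_l)` for `B` (the substitution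
  intertwines the two diagonal actions, checked on variables);
* `isEquivariantDetRepr_subst_const` — consequently, for any set `S` of free generators each of
  which so extends, and any `f'` with `IsAffineDetRepr f' (B.map (aeval g))`, the substituted matrix
  is a `closure S`-equivariant affine determinantal representation of `f'`
  (`IsEquivariantDetRepr.of_generators`).

With the pin algebra of `…StubAbsorbingSacrificePin.lean` (`per_n ↦ C (∏ t) · per_{n'}`, cofactor
`q ↦ C κ ≠ 0`) this is the whole TRANSPORT of branch (β); what remains OPEN in stub 2 is the
EXTENSION analysis — which free generators extend under the pinned constraint `d_{p₀.1} e_{p₀.2} = 1`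
(the card's re-matching cases / the character `χ`, expected `T_χ ⊇ T¹ = torusGen n' 1 𝟙`).
Honest framing: helper plumbing on a registered line; `stub_absorbingSacrifice`, crux 16133 and
route FreeSubtorus stay OPEN; census-neutral; `VP ≠ VNP` is NOT proved.

References: the floor file `Theorems/FreeSubtorusSubtorusCoveringStubSubstLifts.lean` (whose proof
this one follows line by line); [cite: LandsbergRessayre2017, Def. 1.3, Thm. 2.8, §6].
-/

set_option linter.dupNamespace false

noncomputable section

namespace Summit.ValiantsHypothesis.ValiantsHypothesis.Theorems.FreeSubtorusOrbitDimensionBound.AbsorbingSacrifice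

open Literature.Computability.AlgebraicComplexity MvPolynomial
open Literature.Computability.AlgebraicComplexity.Grenet (linSubst_diagonal_X)

/-- A diagonal matrix with unit diagonal entries is the matrix of an element of `GL`. [folklore] -/
private theorem exists_gl_coe_eq_diagonal {ι : Type*} [Fintype ι] [DecidableEq ι] (u : ι → ℂˣ) :
    ∃ γ : GL ι ℂ, (γ : Matrix ι ι ℂ) = Matrix.diagonal fun i => (u i : ℂ) :=
  ⟨⟨Matrix.diagonal fun i => (u i : ℂ), Matrix.diagonal fun i => ((u i)⁻¹ : ℂˣ),
    by rw [Matrix.diagonal_mul_diagonal, ← Matrix.diagonal_one]; congr 1; funext i; simp,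
    by rw [Matrix.diagonal_mul_diagonal, ← Matrix.diagonal_one]; congr 1; funext i; simp⟩, rfl⟩

/-- **Lifts through a substitution with constants.**  Let `B` be an affine determinantal
representation (of any `f`) equivariant, with exact lifts, under the torus `T_Λ` generated by the
`diag(d_k e_l)`, `(d, e) ∈ (ℂˣ)^{n'+s} × (ℂˣ)^{n'+s}` satisfying the `Λ`-relations.  Let `aeval g`
keep the free `n' × n'` block and send every other variable to a constant (`c₁₂`, `c₂₁`, `c₂₂` on
the three non-free blocks).  If the free generator `γ' = diag(d'_k e'_l)` extends to such a `(d, e)`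
agreeing with `(d', e')` on the free block and fixing every NON-ZERO constant
(`d_{p.1} e_{p.2} = 1` whenever the constant at `p` is `≠ 0`), then `γ'` lifts exactly for
`B.map (aeval g)` — with the lift of `diag(d_k e_l)` for `B`, because `aeval g` intertwines the two
substitutions. (The floor's `stub_substLifts` is the case `c₁₂ = c₂₁ = 0`, `c₂₂ = 1`.)
[cite: LandsbergRessayre2017, Def. 1.3, §6] -/
theorem substLifts_const (n' s r m : ℕ) (Λ : Fin r → (Fin (n' + s) ⊕ Fin (n' + s)) → ℤ)
    (f : MvPolynomial (Fin (n' + s) × Fin (n' + s)) ℂ)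
    (B : Matrix (Fin m) (Fin m) (MvPolynomial (Fin (n' + s) × Fin (n' + s)) ℂ))
    (g : Fin (n' + s) × Fin (n' + s) → MvPolynomial (Fin n' × Fin n') ℂ)
    (c₁₂ : Fin n' → Fin s → ℂ) (c₂₁ : Fin s → Fin n' → ℂ) (c₂₂ : Fin s → Fin s → ℂ)
    (hg₁ : ∀ k l, g (Fin.castAdd s k, Fin.castAdd s l) = X (k, l))
    (hg₂ : ∀ k j, g (Fin.castAdd s k, Fin.natAdd n' j) = C (c₁₂ k j))
    (hg₃ : ∀ j l, g (Fin.natAdd n' j, Fin.castAdd s l) = C (c₂₁ j l))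
    (hg₄ : ∀ j j', g (Fin.natAdd n' j, Fin.natAdd n' j') = C (c₂₂ j j'))
    (hB : IsEquivariantDetRepr (Subgroup.closure
        {γ : Matrix.GeneralLinearGroup (Fin (n' + s) × Fin (n' + s)) ℂ |
          ∃ d e : Fin (n' + s) → ℂˣ,
            (∀ i, (∏ k, (d k) ^ (Λ i (Sum.inl k))) * (∏ l, (e l) ^ (Λ i (Sum.inr l))) = 1) ∧
            (γ : Matrix (Fin (n' + s) × Fin (n' + s)) (Fin (n' + s) × Fin (n' + s)) ℂ) =
              Matrix.diagonal (fun p => (d p.1 : ℂ) * (e p.2 : ℂ))}) f B)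
    (d' e' : Fin n' → ℂ) (d e : Fin (n' + s) → ℂˣ)
    (hrel : ∀ i, (∏ k, (d k) ^ (Λ i (Sum.inl k))) * (∏ l, (e l) ^ (Λ i (Sum.inr l))) = 1)
    (hfree : ∀ k l, (d (Fin.castAdd s k) : ℂ) * (e (Fin.castAdd s l) : ℂ) = d' k * e' l)
    (h₁₂ : ∀ k j, c₁₂ k j ≠ 0 → (d (Fin.castAdd s k) : ℂ) * (e (Fin.natAdd n' j) : ℂ) = 1)
    (h₂₁ : ∀ j l, c₂₁ j l ≠ 0 → (d (Fin.natAdd n' j) : ℂ) * (e (Fin.castAdd s l) : ℂ) = 1)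
    (h₂₂ : ∀ j j', c₂₂ j j' ≠ 0 → (d (Fin.natAdd n' j) : ℂ) * (e (Fin.natAdd n' j') : ℂ) = 1)
    (γ' : Matrix.GeneralLinearGroup (Fin n' × Fin n') ℂ)
    (hγ' : (γ' : Matrix (Fin n' × Fin n') (Fin n' × Fin n') ℂ) =
      Matrix.diagonal (fun p => d' p.1 * e' p.2)) :
    ∃ g₁ h₁ : GL (Fin m) ℂ,
      Matrix.linSubstEntries γ' (B.map (MvPolynomial.aeval g)) =
        (g₁ : Matrix (Fin m) (Fin m) ℂ).map C * B.map (MvPolynomial.aeval g) *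
          ((h₁⁻¹ : GL (Fin m) ℂ) : Matrix (Fin m) (Fin m) ℂ).map C := by
  -- the torus element `γ = diag(d_k e_l) ∈ T_Λ` and its lift for `B`
  obtain ⟨γ, hγ⟩ : ∃ γ : GL (Fin (n' + s) × Fin (n' + s)) ℂ,
      (γ : Matrix (Fin (n' + s) × Fin (n' + s)) (Fin (n' + s) × Fin (n' + s)) ℂ) =
        Matrix.diagonal (fun p => (d p.1 : ℂ) * (e p.2 : ℂ)) :=
    exists_gl_coe_eq_diagonal (fun p : Fin (n' + s) × Fin (n' + s) => d p.1 * e p.2)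
  have hγmem : γ ∈ Subgroup.closure
      {γ : Matrix.GeneralLinearGroup (Fin (n' + s) × Fin (n' + s)) ℂ |
        ∃ d e : Fin (n' + s) → ℂˣ,
          (∀ i, (∏ k, (d k) ^ (Λ i (Sum.inl k))) * (∏ l, (e l) ^ (Λ i (Sum.inr l))) = 1) ∧
          (γ : Matrix (Fin (n' + s) × Fin (n' + s)) (Fin (n' + s) × Fin (n' + s)) ℂ) =
            Matrix.diagonal (fun p => (d p.1 : ℂ) * (e p.2 : ℂ))} :=
    Subgroup.subset_closure ⟨d, e, hrel, hγ⟩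
  obtain ⟨g₁, h₁, hlift⟩ := hB.2 γ hγmem
  -- a constant is fixed by both substitutions as soon as `γ` fixes it
  have hconst : ∀ (a : ℂ) (w : ℂ), (a ≠ 0 → w = 1) →
      w • (C a : MvPolynomial (Fin n' × Fin n') ℂ) =
        linSubst (Fin n' × Fin n') ℂ (γ' : Matrix (Fin n' × Fin n') (Fin n' × Fin n') ℂ) (C a) := by
    intro a w hw
    rw [← algebraMap_eq, AlgHom.commutes]
    by_cases ha : a = 0
    · rw [ha, map_zero, smul_zero]
    · rw [hw ha, one_smul]
  -- KEY: `aeval g` intertwines the substitution by `γ` with the substitution by `γ'`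
  have key : (aeval g).comp (linSubst (Fin (n' + s) × Fin (n' + s)) ℂ
        (γ : Matrix (Fin (n' + s) × Fin (n' + s)) (Fin (n' + s) × Fin (n' + s)) ℂ)) =
      (linSubst (Fin n' × Fin n') ℂ (γ' : Matrix (Fin n' × Fin n') (Fin n' × Fin n') ℂ)).comp
        (aeval g) := by
    apply MvPolynomial.algHom_ext
    rintro ⟨p₁, p₂⟩
    rw [AlgHom.comp_apply, AlgHom.comp_apply, hγ, linSubst_diagonal_X, map_smul, aeval_X]
    dsimp only
    induction p₁ using Fin.addCases with
    | left k =>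
      induction p₂ using Fin.addCases with
      | left l =>
        rw [hg₁, hfree, hγ', linSubst_diagonal_X]
      | right j =>
        rw [hg₂]
        exact hconst _ _ (h₁₂ k j)
    | right j =>
      induction p₂ using Fin.addCases with
      | left l =>
        rw [hg₃]
        exact hconst _ _ (h₂₁ j l)
      | right j' =>
        rw [hg₄]
        exact hconst _ _ (h₂₂ j j')
  -- constants are fixed by `aeval g`
  have hC : ∀ M : Matrix (Fin m) (Fin m) ℂ,
      (M.map C : Matrix (Fin m) (Fin m) (MvPolynomial (Fin (n' + s) × Fin (n' + s)) ℂ)).map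
          (aeval g) =
        (M.map C : Matrix (Fin m) (Fin m) (MvPolynomial (Fin n' × Fin n') ℂ)) := by
    intro M
    rw [Matrix.map_map]
    congr 1
    funext a
    simp
  refine ⟨g₁, h₁, ?_⟩
  calc Matrix.linSubstEntries γ' (B.map (MvPolynomial.aeval g))
      = (Matrix.linSubstEntries γ B).map (MvPolynomial.aeval g) := by
        simp only [Matrix.linSubstEntries, Matrix.map_map]
        congr 1
        funext f
        exact (AlgHom.congr_fun key f).symm
    _ = (g₁ : Matrix (Fin m) (Fin m) ℂ).map C * B.map (MvPolynomial.aeval g) *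
          ((h₁⁻¹ : GL (Fin m) ℂ) : Matrix (Fin m) (Fin m) ℂ).map C := by
        rw [hlift, Matrix.map_mul, Matrix.map_mul, hC, hC]

/-- **Equivariance of the substituted representation under the extendable free generators.**
In the situation of `substLifts_const`, let `S` be a set of free generators `diag(d'_k e'_l)` each of
which extends (to some `(d, e)` satisfying the `Λ`-relations, agreeing on the free block and fixing
the non-zero constants).  If `B.map (aeval g)` is an affine determinantal representation of `f'`
(e.g. after rescaling the constant `∏ t · κ` away), then it is `closure S`-equivariant with exact
lifts (`IsEquivariantDetRepr.of_generators`).  In branch (β) of stub 2 the successor shows that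
`S ⊇ torusGen n' 1 𝟙` (the per-invariant torus `T¹`) and concludes with `stub_perInvariantTorusBound`.
[cite: LandsbergRessayre2017, Def. 1.3, §6] -/
theorem isEquivariantDetRepr_subst_const (n' s r m : ℕ)
    (Λ : Fin r → (Fin (n' + s) ⊕ Fin (n' + s)) → ℤ)
    (f : MvPolynomial (Fin (n' + s) × Fin (n' + s)) ℂ) (f' : MvPolynomial (Fin n' × Fin n') ℂ)
    (B : Matrix (Fin m) (Fin m) (MvPolynomial (Fin (n' + s) × Fin (n' + s)) ℂ))
    (g : Fin (n' + s) × Fin (n' + s) → MvPolynomial (Fin n' × Fin n') ℂ)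
    (c₁₂ : Fin n' → Fin s → ℂ) (c₂₁ : Fin s → Fin n' → ℂ) (c₂₂ : Fin s → Fin s → ℂ)
    (hg₁ : ∀ k l, g (Fin.castAdd s k, Fin.castAdd s l) = X (k, l))
    (hg₂ : ∀ k j, g (Fin.castAdd s k, Fin.natAdd n' j) = C (c₁₂ k j))
    (hg₃ : ∀ j l, g (Fin.natAdd n' j, Fin.castAdd s l) = C (c₂₁ j l))
    (hg₄ : ∀ j j', g (Fin.natAdd n' j, Fin.natAdd n' j') = C (c₂₂ j j'))
    (hB : IsEquivariantDetRepr (Subgroup.closure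
        {γ : Matrix.GeneralLinearGroup (Fin (n' + s) × Fin (n' + s)) ℂ |
          ∃ d e : Fin (n' + s) → ℂˣ,
            (∀ i, (∏ k, (d k) ^ (Λ i (Sum.inl k))) * (∏ l, (e l) ^ (Λ i (Sum.inr l))) = 1) ∧
            (γ : Matrix (Fin (n' + s) × Fin (n' + s)) (Fin (n' + s) × Fin (n' + s)) ℂ) =
              Matrix.diagonal (fun p => (d p.1 : ℂ) * (e p.2 : ℂ))}) f B)
    (hB' : IsAffineDetRepr f' (B.map (MvPolynomial.aeval g)))
    (S : Set (Matrix.GeneralLinearGroup (Fin n' × Fin n') ℂ))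
    (hS : ∀ γ' ∈ S, ∃ (d' e' : Fin n' → ℂ) (d e : Fin (n' + s) → ℂˣ),
      (γ' : Matrix (Fin n' × Fin n') (Fin n' × Fin n') ℂ) = Matrix.diagonal (fun p => d' p.1 * e' p.2) ∧
      (∀ i, (∏ k, (d k) ^ (Λ i (Sum.inl k))) * (∏ l, (e l) ^ (Λ i (Sum.inr l))) = 1) ∧
      (∀ k l, (d (Fin.castAdd s k) : ℂ) * (e (Fin.castAdd s l) : ℂ) = d' k * e' l) ∧
      (∀ k j, c₁₂ k j ≠ 0 → (d (Fin.castAdd s k) : ℂ) * (e (Fin.natAdd n' j) : ℂ) = 1) ∧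
      (∀ j l, c₂₁ j l ≠ 0 → (d (Fin.natAdd n' j) : ℂ) * (e (Fin.castAdd s l) : ℂ) = 1) ∧
      (∀ j j', c₂₂ j j' ≠ 0 → (d (Fin.natAdd n' j) : ℂ) * (e (Fin.natAdd n' j') : ℂ) = 1)) :
    IsEquivariantDetRepr (Subgroup.closure S) f' (B.map (MvPolynomial.aeval g)) := by
  refine IsEquivariantDetRepr.of_generators hB' fun γ' hγ' => ?_
  obtain ⟨d', e', d, e, hγ', hrel, hfree, h₁₂, h₂₁, h₂₂⟩ := hS γ' hγ'
  exact substLifts_const n' s r m Λ f B g c₁₂ c₂₁ c₂₂ hg₁ hg₂ hg₃ hg₄ hB d' e' d e hrel hfree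
    h₁₂ h₂₁ h₂₂ γ' hγ'

end Summit.ValiantsHypothesis.ValiantsHypothesis.Theorems.FreeSubtorusOrbitDimensionBound.AbsorbingSacrifice

end
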